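import Summits.QuantumFields.YangMills.Theorems.UnitScaleTiltProp7RRowOfJRow
import HarnessLib

/-!
# Route `UnitScaleTilt`, crux K1 «MinimiserStabilityRegPr» (stmt-QuantumFields-19200), route-R E′ growth side, ℛ-line, J-ROW★ curved — brick B-J4 «THE CURRENT PAIRING BOUND
# FOR AN ARBITRARY TEST FIELD»: for ANY bond field `B`, `⟨B, CURRENT(φ)⟩ ≤ (s∕2)·Σ_{μ<ν}|curl_U B|² + K(φ)∕(2s) + a·(θ·d·Σ|B|² + θ⁻¹·(4K(φ) + 2d·M(φ)))` (`s, θ > 0` free)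
# — the identity ✓ `sum_re_trace_curl_mul_curl_covD_eq_current_add_curv` rearranged, the curvature pairing in WEIGHTED product form (value-free, ✓p684887 §1), Cauchy–Schwarz

Cell `ym3-torus`, width seat `ym-ust-19200-w4` (gen 7); LOCATE v4 (HOME `ym-ust-19200-w4/g7/LOCATE-JROW-CURVED-V4-w4g7.md`) steps (a)(b).  WHERE IT SITS: J-ROW★'s
inhabitant tests the identity with `B :=` (a cut or recentred copy of) the current commutator field `[J;φ]` itself; this brick is the `B`-generic half of that argument — what
remains for the assembly (B-J5) is `‖curl_U B‖² ≤ (c∕ℓ²)·⟨B, CURRENT⟩ + …` for the chosen `B` (B-J2∕B-J3: Leibniz + the covariant tent structure `J = Q_U^*λ` + ✓ B-J1 tent-Gram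
coercivity).  The weight `θ` is what keeps the `D_Uφ`-part of the curvature pairing at `O(a²ℓ²)·M` after the `ℓ²`-normalisation (LOCATE v4 (a)).  THEOREMS ONLY (0 `def`,
0 `sorry`); `--supports stmt-QuantumFields-19200`, count-neutral.  YM₃ on T³ is a ladder rung (R3), not the Clay problem; nothing here claims J-ROW★, hKg-K, S3, E′, a stub, the
crux, d = 4 or the mass gap.

WHAT IS PROVED (ns `…Theorems.Prop7CurrentPairingBound`; letters of ✓p684887: `K(φ)`, `M(φ)`, CURRENT∕CURVATURE terms of the tree identity VERBATIM).
* §1 ★ `abs_re_trace_curv_le_weighted` — `|Re tr(Xᴴ(R(Π)Z − Z))| ≤ a·(θ|X|² + θ⁻¹|Z|²)` (`θ > 0`; the tree's `θ = 1` lemma rescaled);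
  ★★ `curv_pairing_le_weighted (B) (hθ)` — `Σ_xΣ_μΣ_ν|Re tr((B_μ(x))ᴴ·CURV_{νμ}(x))| ≤ a·(θ·d·Σ|B|² + θ⁻¹·(4K(φ) + 2d·M(φ)))`.
* §2 ★★ `current_pairing_eq` — `Σ_xΣ_μ Re tr((B_μ(x))ᴴ·CUR_μ(x)) = Σ_{x,μ<ν} Re tr((curl_U B)ᴴ·curl_U D_Uφ) − Σ_xΣ_μΣ_ν Re tr((B_μ(x))ᴴ·CURV_{νμ}(x))`;
  ★★★ `current_pairing_le (hU ha0 ha φ B hs hθ)` — the displayed bound.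
HONEST SCOPE.  Exact algebra + AM–GM over two landed files; no estimate on `curl_U B` (that is B-J2∕B-J3∕B-J5).

References: T. Bałaban, CMP 99 (1985) 389–434 [Balaban1985BackgroundPropagators] ((3.3)–(3.4) pp.390–391, (3.9) p.392); CMP 102 (1985) 277–309 [Balaban1985Variational]
((135) p.298, Prop. 7 p.299).
-/

set_option autoImplicit false

noncomputable section

open scoped BigOperators Matrix.Norms.L2Operator Matrix

namespace Summit.QuantumFields.YangMills.Theorems.Prop7CurrentPairingBound

open Literature.MathematicalPhysics.QuantumFieldTheory.Balaban1983to89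
open B9Eq39Adjoint (R R_def R_add R_sub R_neg covD covDstar curl plaqU curl_swap curl_self)
open B9TorusCalculus (torusT torusT_apply torusT_symm_apply torusT_comm)
open Summit.QuantumFields.YangMills.Theorems.Prop7CovariantCoercivity (re_trace_conjTranspose_mul_self two_mul_abs_re_trace_le sum_norm_sq_add_le sum_norm_sq_R)
open Summit.QuantumFields.YangMills.Theorems.Prop7CovCurrentPairing (sum_re_trace_curl_mul_curl_covD_eq_current_add_curv abs_re_trace_conjTranspose_mul_conj_sub_le)
open Summit.QuantumFields.YangMills.Theorems.Prop7RRowOfJRow (sum_norm_sq_covDstar_transported_le)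

variable {P : Params} {i : ℕ} {N : ℕ} (U : Fin P.d → Site P i → (Matrix (Fin N) (Fin N) ℂ)ˣ)

/-! ## §1 The curvature pairing, weighted, for an arbitrary test field -/

/-- `R(u)` commutes with complex scalars. [folklore] -/
theorem R_smul (u : (Matrix (Fin N) (Fin N) ℂ)ˣ) (c : ℂ) (X : Matrix (Fin N) (Fin N) ℂ) : R u (c • X) = c • R u X := by
  simp only [R_def, Matrix.mul_smul, Matrix.smul_mul]

/-- `Σ_jk‖(c•X)_jk‖² = ‖c‖²·Σ_jk‖X_jk‖²`. [folklore] -/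
theorem sum_norm_sq_smul (c : ℂ) (X : Matrix (Fin N) (Fin N) ℂ) :
    ∑ j : Fin N, ∑ k : Fin N, ‖(c • X) j k‖ ^ 2 = ‖c‖ ^ 2 * ∑ j : Fin N, ∑ k : Fin N, ‖X j k‖ ^ 2 := by
  rw [Finset.mul_sum]
  refine Finset.sum_congr rfl fun j _ => ?_
  rw [Finset.mul_sum]
  refine Finset.sum_congr rfl fun k _ => ?_
  rw [Matrix.smul_apply, smul_eq_mul, norm_mul, mul_pow]

/-- ★ **WEIGHTED CURVATURE PAIRING, POINTWISE**: for unitary `Π` with `‖Π − 1‖ ≤ a` and `θ > 0`, `|Re tr(Xᴴ(R(Π)Z − Z))| ≤ a·(θ·Σ|X_jk|² + θ⁻¹·Σ|Z_jk|²)` (the tree's `θ = 1` bound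
at `X√θ`, `Z∕√θ`). [cite: Balaban1985Variational, (135) p.298] -/
theorem abs_re_trace_curv_le_weighted [NeZero N] (hU : ∀ (ν : Fin P.d) (x : Site P i), (U ν x : Matrix (Fin N) (Fin N) ℂ) ∈ unitary (Matrix (Fin N) (Fin N) ℂ))
    {a : ℝ} (ν μ : Fin P.d) (x : Site P i) (ha : ‖(plaqU (torusT P i) U ν μ x : Matrix (Fin N) (Fin N) ℂ) - 1‖ ≤ a)
    {θ : ℝ} (hθ : 0 < θ) (X Z : Matrix (Fin N) (Fin N) ℂ) :
    |((Xᴴ * (R (plaqU (torusT P i) U ν μ x) Z - Z)).trace).re|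
      ≤ a * (θ * ∑ j : Fin N, ∑ k : Fin N, ‖X j k‖ ^ 2 + θ⁻¹ * ∑ j : Fin N, ∑ k : Fin N, ‖Z j k‖ ^ 2) := by
  set c : ℝ := Real.sqrt θ with hc
  have hc0 : 0 < c := Real.sqrt_pos.mpr hθ
  have hcc : c * c = θ := by rw [hc, Real.mul_self_sqrt hθ.le]
  have h := abs_re_trace_conjTranspose_mul_conj_sub_le U hU ν μ x ha ((c : ℂ) • X) (((c⁻¹ : ℝ) : ℂ) • Z)
  have e : (((c : ℂ) • X)ᴴ * (R (plaqU (torusT P i) U ν μ x) ((((c⁻¹ : ℝ) : ℂ)) • Z) - (((c⁻¹ : ℝ) : ℂ)) • Z))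
      = Xᴴ * (R (plaqU (torusT P i) U ν μ x) Z - Z) := by
    rw [R_smul, ← smul_sub, Matrix.conjTranspose_smul, Matrix.smul_mul, Matrix.mul_smul, smul_smul]
    have : star (c : ℂ) * ((c⁻¹ : ℝ) : ℂ) = 1 := by
      rw [Complex.star_def, Complex.conj_ofReal, ← Complex.ofReal_mul, mul_inv_cancel₀ hc0.ne', Complex.ofReal_one]
    rw [this, one_smul]
  rw [e, sum_norm_sq_smul, sum_norm_sq_smul, Complex.norm_real, Complex.norm_real, Real.norm_of_nonneg hc0.le,
    Real.norm_of_nonneg (inv_nonneg.mpr hc0.le), inv_pow, sq, hcc] at h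
  exact h

/-- ★★ **WEIGHTED CURVATURE PAIRING FOR AN ARBITRARY TEST FIELD**: `Σ_xΣ_μΣ_ν|Re tr((B_μ(x))ᴴ·CURV_{νμ}(x))| ≤ a·(θ·d·Σ_xΣ_μ|B_μ(x)|² + θ⁻¹·(4K(φ) + 2d·M(φ)))`, the inner letter
`|Z|² ≤ 2|curl_U D_Uφ(p_{νμ}(x−e_ν))|² + 2|D_νφ(x+e_μ)|²` by ✓p684887 §1. [cite: Balaban1985Variational, (135) p.298; Balaban1985BackgroundPropagators, (3.9) p.392] -/
theorem curv_pairing_le_weighted [NeZero N] (hU : ∀ (ν : Fin P.d) (x : Site P i), (U ν x : Matrix (Fin N) (Fin N) ℂ) ∈ unitary (Matrix (Fin N) (Fin N) ℂ))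
    {a : ℝ} (ha0 : 0 ≤ a) (ha : ∀ (μ ν : Fin P.d) (x : Site P i), ‖(plaqU (torusT P i) U μ ν x : Matrix (Fin N) (Fin N) ℂ) - 1‖ ≤ a)
    (φ : Site P i → Matrix (Fin N) (Fin N) ℂ) (B : Fin P.d → Site P i → Matrix (Fin N) (Fin N) ℂ) {θ : ℝ} (hθ : 0 < θ) :
    ∑ x : Site P i, ∑ μ : Fin P.d, ∑ ν : Fin P.d,
        |(((B μ x)ᴴ *
            (R (plaqU (torusT P i) U ν μ x) (covDstar (torusT P i) U ν (fun y => R (U μ y * U ν (y.shift μ)) (φ ((y.shift μ).shift ν))) x)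
                - covDstar (torusT P i) U ν (fun y => R (U μ y * U ν (y.shift μ)) (φ ((y.shift μ).shift ν))) x)).trace).re|
      ≤ a * (θ * P.d * (∑ x : Site P i, ∑ μ : Fin P.d, ∑ j : Fin N, ∑ k : Fin N, ‖(B μ x) j k‖ ^ 2)
          + θ⁻¹ * (4 * ∑ x : Site P i, ∑ μ : Fin P.d, ∑ ν : Fin P.d, (if μ < ν then
        ∑ j : Fin N, ∑ k : Fin N, ‖(curl (torusT P i) U (fun κ => covD (torusT P i) U κ φ) μ ν x) j k‖ ^ 2 else 0)
            + 2 * P.d * (∑ x : Site P i, ∑ μ : Fin P.d, ∑ j : Fin N, ∑ k : Fin N, ‖(covD (torusT P i) U μ φ x) j k‖ ^ 2))) := by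
  -- letters
  set Bn : Fin P.d → Site P i → ℝ := fun μ x => ∑ j : Fin N, ∑ k : Fin N, ‖(B μ x) j k‖ ^ 2 with hBn
  set Dn : Fin P.d → Site P i → ℝ := fun μ x => ∑ j : Fin N, ∑ k : Fin N, ‖(covD (torusT P i) U μ φ x) j k‖ ^ 2 with hDn
  set Cn : Fin P.d → Fin P.d → Site P i → ℝ := fun μ ν x =>
    ∑ j : Fin N, ∑ k : Fin N, ‖(curl (torusT P i) U (fun κ => covD (torusT P i) U κ φ) μ ν x) j k‖ ^ 2 with hCn
  have hθi : 0 ≤ θ⁻¹ := inv_nonneg.mpr hθ.le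
  -- pointwise
  have hpt : ∀ (x : Site P i) (μ ν : Fin P.d),
      |(((B μ x)ᴴ *
            (R (plaqU (torusT P i) U ν μ x) (covDstar (torusT P i) U ν (fun y => R (U μ y * U ν (y.shift μ)) (φ ((y.shift μ).shift ν))) x)
                - covDstar (torusT P i) U ν (fun y => R (U μ y * U ν (y.shift μ)) (φ ((y.shift μ).shift ν))) x)).trace).re|
        ≤ a * θ * Bn μ x + 2 * a * θ⁻¹ * Cn ν μ (x.unshift ν) + 2 * a * θ⁻¹ * Dn ν (x.shift μ) := by
    intro x μ ν
    refine (abs_re_trace_curv_le_weighted U hU ν μ x (ha ν μ x) hθ _ _).trans ?_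
    have h := mul_le_mul_of_nonneg_left (mul_le_mul_of_nonneg_left (sum_norm_sq_covDstar_transported_le U hU φ μ ν x) hθi) ha0
    simp only [hBn, hCn, hDn]
    nlinarith [h]
  have hS := Finset.sum_le_sum fun x (_ : x ∈ Finset.univ) =>
    Finset.sum_le_sum fun μ (_ : μ ∈ Finset.univ) => Finset.sum_le_sum fun ν (_ : ν ∈ Finset.univ) => hpt x μ ν
  refine hS.trans (le_of_eq ?_)
  simp only [Finset.sum_add_distrib, ← Finset.mul_sum]
  -- (i) the ν-constant piece
  have e1 : ∑ x : Site P i, ∑ μ : Fin P.d, ∑ _ν : Fin P.d, Bn μ x = P.d * ∑ x : Site P i, ∑ μ : Fin P.d, Bn μ x := by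
    rw [Finset.mul_sum]
    refine Finset.sum_congr rfl fun x _ => ?_
    rw [Finset.mul_sum]
    refine Finset.sum_congr rfl fun μ _ => ?_
    rw [Finset.sum_const, Finset.card_univ, Fintype.card_fin, nsmul_eq_mul]
  -- (ii) reindex the shifted sums over the torus
  have e2 : ∑ x : Site P i, ∑ μ : Fin P.d, ∑ ν : Fin P.d, Cn ν μ (x.unshift ν)
      = ∑ x : Site P i, ∑ μ : Fin P.d, ∑ ν : Fin P.d, Cn ν μ x := by
    rw [Finset.sum_comm]
    conv_rhs => rw [Finset.sum_comm]
    refine Finset.sum_congr rfl fun μ _ => ?_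
    rw [Finset.sum_comm]
    conv_rhs => rw [Finset.sum_comm]
    refine Finset.sum_congr rfl fun ν _ => ?_
    exact Fintype.sum_equiv (torusT P i ν).symm _ _ fun x => rfl
  have e3 : ∑ x : Site P i, ∑ μ : Fin P.d, ∑ ν : Fin P.d, Dn ν (x.shift μ)
      = P.d * ∑ x : Site P i, ∑ μ : Fin P.d, Dn μ x := by
    rw [Finset.sum_comm]
    have : ∀ μ : Fin P.d, ∑ x : Site P i, ∑ ν : Fin P.d, Dn ν (x.shift μ) = ∑ x : Site P i, ∑ ν : Fin P.d, Dn ν x := fun μ =>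
      Fintype.sum_equiv (torusT P i μ) _ _ fun x => rfl
    simp only [this, Finset.sum_const, Finset.card_univ, Fintype.card_fin, nsmul_eq_mul]
  -- (iii) the full curl sum is twice the ordered one
  have hsw : ∀ (x : Site P i) (μ ν : Fin P.d), Cn ν μ x = Cn μ ν x := fun x μ ν => by
    simp only [hCn, curl_swap (torusT P i) U (fun κ => covD (torusT P i) U κ φ) μ ν x, Matrix.neg_apply, norm_neg]
  have hdiag : ∀ (x : Site P i) (μ : Fin P.d), Cn μ μ x = 0 := fun x μ => by simp [hCn]
  have e4 : ∑ x : Site P i, ∑ μ : Fin P.d, ∑ ν : Fin P.d, Cn ν μ x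
      = 2 * ∑ x : Site P i, ∑ μ : Fin P.d, ∑ ν : Fin P.d, (if μ < ν then Cn μ ν x else 0) := by
    rw [Finset.mul_sum]
    refine Finset.sum_congr rfl fun x _ => ?_
    have hsplit : ∀ μ ν : Fin P.d, Cn ν μ x = (if μ < ν then Cn μ ν x else 0) + (if ν < μ then Cn ν μ x else 0) := by
      intro μ ν
      rcases lt_trichotomy μ ν with h | h | h
      · rw [if_pos h, if_neg (not_lt.mpr h.le), add_zero, hsw]
      · subst h; rw [if_neg (lt_irrefl _), add_zero, hdiag]
      · rw [if_neg (not_lt.mpr h.le), if_pos h, zero_add]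
    have hswap : ∑ μ : Fin P.d, ∑ ν : Fin P.d, (if ν < μ then Cn ν μ x else 0)
        = ∑ μ : Fin P.d, ∑ ν : Fin P.d, (if μ < ν then Cn μ ν x else 0) := by
      rw [Finset.sum_comm]
    rw [Finset.sum_congr rfl fun μ _ => Finset.sum_congr rfl fun ν _ => hsplit μ ν]
    simp only [Finset.sum_add_distrib]
    rw [hswap, two_mul]
  rw [e1, e2, e3, e4]
  ring

/-! ## §2 The current pairing for an arbitrary test field -/

/-- ★★ **THE CURRENT PAIRING IS THE CURL PAIRING MINUS THE CURVATURE PAIRING** — ✓ `sum_re_trace_curl_mul_curl_covD_eq_current_add_curv`, rearranged.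
[cite: Balaban1985BackgroundPropagators, (3.3)-(3.4) pp.390-391, (3.9) p.392] -/
theorem current_pairing_eq (hU : ∀ (ν : Fin P.d) (x : Site P i), (U ν x : Matrix (Fin N) (Fin N) ℂ) ∈ unitary (Matrix (Fin N) (Fin N) ℂ))
    (φ : Site P i → Matrix (Fin N) (Fin N) ℂ) (B : Fin P.d → Site P i → Matrix (Fin N) (Fin N) ℂ) :
    ∑ x : Site P i, ∑ μ : Fin P.d, (((B μ x)ᴴ * ∑ ν : Fin P.d,
            (R ((U ν (x.unshift ν))⁻¹ * plaqU (torusT P i) U ν μ (x.unshift ν) * U ν (x.unshift ν))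
                  (R (U ν (x.unshift ν))⁻¹ (R (U μ (x.unshift ν) * U ν ((x.unshift ν).shift μ)) (φ (((x.unshift ν).shift μ).shift ν))))
              - R (plaqU (torusT P i) U ν μ x)
                  (R (U ν (x.unshift ν))⁻¹ (R (U μ (x.unshift ν) * U ν ((x.unshift ν).shift μ)) (φ (((x.unshift ν).shift μ).shift ν)))))).trace).re
      = ∑ x : Site P i, ∑ μ : Fin P.d, ∑ ν : Fin P.d,
          (if μ < ν then (((curl (torusT P i) U B μ ν x)ᴴ * curl (torusT P i) U (fun κ => covD (torusT P i) U κ φ) μ ν x).trace).re else 0)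
        - ∑ x : Site P i, ∑ μ : Fin P.d, ∑ ν : Fin P.d, (((B μ x)ᴴ *
            (R (plaqU (torusT P i) U ν μ x) (covDstar (torusT P i) U ν (fun y => R (U μ y * U ν (y.shift μ)) (φ ((y.shift μ).shift ν))) x)
                - covDstar (torusT P i) U ν (fun y => R (U μ y * U ν (y.shift μ)) (φ ((y.shift μ).shift ν))) x)).trace).re := by
  rw [sum_re_trace_curl_mul_curl_covD_eq_current_add_curv U hU B φ, eq_sub_iff_add_eq, ← Finset.sum_add_distrib]
  refine Finset.sum_congr rfl fun x _ => ?_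
  rw [← Finset.sum_add_distrib]
  refine Finset.sum_congr rfl fun μ _ => ?_
  rw [Finset.sum_add_distrib, Matrix.mul_add, Matrix.trace_add, Complex.add_re]
  congr 1
  rw [Finset.mul_sum, Matrix.trace_sum, Complex.re_sum]

/-- ★★★ **THE CURRENT PAIRING BOUND FOR AN ARBITRARY TEST FIELD.**  Unitary background, `‖U(∂p) − 1‖ ≤ a`, `0 ≤ a`; any `φ`, any bond field `B`; `s, θ > 0`.  THEN
`Σ_xΣ_μ Re tr((B_μ(x))ᴴ·CUR_μ(x)) ≤ (s∕2)·Σ_{x,μ<ν}|curl_U B|² + K(φ)∕(2s) + a·(θ·d·Σ|B|² + θ⁻¹·(4K(φ) + 2d·M(φ)))`.  (B-J5 reads it with `B` = the current commutator field,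
`s ≍ ℓ∕√C`, `θ ≍ ℓ²`: then `‖curl_U B‖² ≲ ℓ⁻²·CUR` closes J-ROW★ with the second slot `O(a²ℓ²)·M`.)
[cite: Balaban1985BackgroundPropagators, (3.9) p.392; Balaban1985Variational, (135) p.298, Prop. 7 p.299] -/
theorem current_pairing_le [NeZero N] (hU : ∀ (ν : Fin P.d) (x : Site P i), (U ν x : Matrix (Fin N) (Fin N) ℂ) ∈ unitary (Matrix (Fin N) (Fin N) ℂ))
    {a : ℝ} (ha0 : 0 ≤ a) (ha : ∀ (μ ν : Fin P.d) (x : Site P i), ‖(plaqU (torusT P i) U μ ν x : Matrix (Fin N) (Fin N) ℂ) - 1‖ ≤ a)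
    (φ : Site P i → Matrix (Fin N) (Fin N) ℂ) (B : Fin P.d → Site P i → Matrix (Fin N) (Fin N) ℂ) {s θ : ℝ} (hs : 0 < s) (hθ : 0 < θ) :
    ∑ x : Site P i, ∑ μ : Fin P.d, (((B μ x)ᴴ * ∑ ν : Fin P.d,
            (R ((U ν (x.unshift ν))⁻¹ * plaqU (torusT P i) U ν μ (x.unshift ν) * U ν (x.unshift ν))
                  (R (U ν (x.unshift ν))⁻¹ (R (U μ (x.unshift ν) * U ν ((x.unshift ν).shift μ)) (φ (((x.unshift ν).shift μ).shift ν))))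
              - R (plaqU (torusT P i) U ν μ x)
                  (R (U ν (x.unshift ν))⁻¹ (R (U μ (x.unshift ν) * U ν ((x.unshift ν).shift μ)) (φ (((x.unshift ν).shift μ).shift ν)))))).trace).re
      ≤ s / 2 * ∑ x : Site P i, ∑ μ : Fin P.d, ∑ ν : Fin P.d, (if μ < ν then
        ∑ j : Fin N, ∑ k : Fin N, ‖(curl (torusT P i) U B μ ν x) j k‖ ^ 2 else 0)
        + s⁻¹ / 2 * ∑ x : Site P i, ∑ μ : Fin P.d, ∑ ν : Fin P.d, (if μ < ν then
        ∑ j : Fin N, ∑ k : Fin N, ‖(curl (torusT P i) U (fun κ => covD (torusT P i) U κ φ) μ ν x) j k‖ ^ 2 else 0)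
        + a * (θ * P.d * (∑ x : Site P i, ∑ μ : Fin P.d, ∑ j : Fin N, ∑ k : Fin N, ‖(B μ x) j k‖ ^ 2)
          + θ⁻¹ * (4 * ∑ x : Site P i, ∑ μ : Fin P.d, ∑ ν : Fin P.d, (if μ < ν then
        ∑ j : Fin N, ∑ k : Fin N, ‖(curl (torusT P i) U (fun κ => covD (torusT P i) U κ φ) μ ν x) j k‖ ^ 2 else 0)
            + 2 * P.d * (∑ x : Site P i, ∑ μ : Fin P.d, ∑ j : Fin N, ∑ k : Fin N, ‖(covD (torusT P i) U μ φ x) j k‖ ^ 2))) := by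
  have hcurv := curv_pairing_le_weighted U hU ha0 ha φ B hθ
  rw [current_pairing_eq U hU φ B]
  -- Cauchy–Schwarz on the curl pairing, plaquette by plaquette
  have hcs : ∑ x : Site P i, ∑ μ : Fin P.d, ∑ ν : Fin P.d,
        (if μ < ν then (((curl (torusT P i) U B μ ν x)ᴴ * curl (torusT P i) U (fun κ => covD (torusT P i) U κ φ) μ ν x).trace).re else 0)
      ≤ s / 2 * ∑ x : Site P i, ∑ μ : Fin P.d, ∑ ν : Fin P.d, (if μ < ν then
        ∑ j : Fin N, ∑ k : Fin N, ‖(curl (torusT P i) U B μ ν x) j k‖ ^ 2 else 0)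
        + s⁻¹ / 2 * ∑ x : Site P i, ∑ μ : Fin P.d, ∑ ν : Fin P.d, (if μ < ν then
        ∑ j : Fin N, ∑ k : Fin N, ‖(curl (torusT P i) U (fun κ => covD (torusT P i) U κ φ) μ ν x) j k‖ ^ 2 else 0) := by
    rw [Finset.mul_sum, Finset.mul_sum, ← Finset.sum_add_distrib]
    refine Finset.sum_le_sum fun x _ => ?_
    rw [Finset.mul_sum, Finset.mul_sum, ← Finset.sum_add_distrib]
    refine Finset.sum_le_sum fun μ _ => ?_
    rw [Finset.mul_sum, Finset.mul_sum, ← Finset.sum_add_distrib]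
    refine Finset.sum_le_sum fun ν _ => ?_
    split_ifs
    · have h := two_mul_abs_re_trace_le hs (curl (torusT P i) U B μ ν x) (curl (torusT P i) U (fun κ => covD (torusT P i) U κ φ) μ ν x)
      have := le_abs_self (((curl (torusT P i) U B μ ν x)ᴴ * curl (torusT P i) U (fun κ => covD (torusT P i) U κ φ) μ ν x).trace).re
      linarith
    · simp
  have habs : -(∑ x : Site P i, ∑ μ : Fin P.d, ∑ ν : Fin P.d, (((B μ x)ᴴ *
            (R (plaqU (torusT P i) U ν μ x) (covDstar (torusT P i) U ν (fun y => R (U μ y * U ν (y.shift μ)) (φ ((y.shift μ).shift ν))) x)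
                - covDstar (torusT P i) U ν (fun y => R (U μ y * U ν (y.shift μ)) (φ ((y.shift μ).shift ν))) x)).trace).re)
      ≤ a * (θ * P.d * (∑ x : Site P i, ∑ μ : Fin P.d, ∑ j : Fin N, ∑ k : Fin N, ‖(B μ x) j k‖ ^ 2)
          + θ⁻¹ * (4 * ∑ x : Site P i, ∑ μ : Fin P.d, ∑ ν : Fin P.d, (if μ < ν then
        ∑ j : Fin N, ∑ k : Fin N, ‖(curl (torusT P i) U (fun κ => covD (torusT P i) U κ φ) μ ν x) j k‖ ^ 2 else 0)
            + 2 * P.d * (∑ x : Site P i, ∑ μ : Fin P.d, ∑ j : Fin N, ∑ k : Fin N, ‖(covD (torusT P i) U μ φ x) j k‖ ^ 2))) := by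
    refine le_trans ?_ hcurv
    rw [← Finset.sum_neg_distrib]
    refine Finset.sum_le_sum fun x _ => ?_
    rw [← Finset.sum_neg_distrib]
    refine Finset.sum_le_sum fun μ _ => ?_
    rw [← Finset.sum_neg_distrib]
    exact Finset.sum_le_sum fun ν _ => neg_le_abs _
  linarith [hcs, habs]

end Summit.QuantumFields.YangMills.Theorems.Prop7CurrentPairingBound

end
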